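import Summits.CriticalPhenomena.PercolationContinuityZ3.Theorems.SahiConjecture
import Summits.CriticalPhenomena.PercolationContinuityZ3.Theorems.PercNearOneGluingNoHeavyLowerTailSahiAbsorbedComparable

/-!
# Sahi's conjecture, ALL orders, reduces to 'non-containing' families of up-sets

Support file (lane `prim-masterthm-p3`, generation 18; `--supports stmt-CriticalPhenomena-4575`).  Pure proofs, no definitions,
no `sorry`, standard axioms.

`forall_sahiConjecture_of_noncontaining`: if for every `n`, every finite distributive lattice with an FKG probability weight, and every
family of `n+2` up-sets in which NO member contains the intersection of the others, `E_{n+2}(1_{W_0}, …, 1_{W_{n+1}}) ≥ 0`, then Sahi's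
conjecture `C_n` holds for every `n` (strong induction on the order through `SahiAbsorbed.sahiPositive_of_noncontaining`; the orders `0, 1, 2`
are theorems).  Families with a comparable pair, a member inside all others, or a member containing the meet of the others never need
to be examined. [this work]
-/

namespace Summit.CriticalPhenomena.PercolationContinuityZ3.Theorems

open Finset Function
open Literature.Combinatorics.Sahi2008

namespace SahiAbsorbed

/-- **SAHI'S CONJECTURE REDUCES TO NON-CONTAINING FAMILIES, AT EVERY ORDER.** [this work] -/
theorem forall_sahiConjecture_of_noncontaining
    (hcore : ∀ (n : ℕ) (α : Type) [DistribLattice α] [Fintype α] [DecidableEq α] (μ : α → ℝ), IsFKGMeasure μ →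
      ∀ W : Fin (n + 2) → Finset α, (∀ j, IsUpperSet (W j : Set α)) →
        (∀ j, ∃ x, (∀ k, k ≠ j → x ∈ W k) ∧ x ∉ W j) → 0 ≤ sahiE μ (n + 2) (fun k => setInd (W k))) :
    ∀ n, SahiConjecture n := by
  intro n
  induction n using Nat.strong_induction_on with
  | _ n ih =>
    match n, ih with
    | 0, _ => exact sahiConjecture_zero
    | 1, _ => exact fun α _ _ μ hμ => sahiPositive_one hμ.nonneg
    | m + 2, ih =>
      intro α _ _ μ hμ
      classical
      exact sahiPositive_of_noncontaining hμ.nonneg hμ.sum_eq_one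
        (fun k hk1 hk2 => ih k (by omega) α μ hμ) (hcore m α μ hμ)

/-- **Inductive form**: the core prover may assume all lower orders. [this work] -/
theorem forall_sahiConjecture_of_noncontaining'
    (hcore : ∀ (n : ℕ), (∀ k, k ≤ n + 1 → SahiConjecture k) →
      ∀ (α : Type) [DistribLattice α] [Fintype α] [DecidableEq α] (μ : α → ℝ), IsFKGMeasure μ →
      ∀ W : Fin (n + 2) → Finset α, (∀ j, IsUpperSet (W j : Set α)) →
        (∀ j, ∃ x, (∀ k, k ≠ j → x ∈ W k) ∧ x ∉ W j) → 0 ≤ sahiE μ (n + 2) (fun k => setInd (W k))) :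
    ∀ n, SahiConjecture n := by
  intro n
  induction n using Nat.strong_induction_on with
  | _ n ih =>
    match n, ih with
    | 0, _ => exact sahiConjecture_zero
    | 1, _ => exact fun α _ _ μ hμ => sahiPositive_one hμ.nonneg
    | m + 2, ih =>
      intro α _ _ μ hμ
      classical
      exact sahiPositive_of_noncontaining hμ.nonneg hμ.sum_eq_one
        (fun k hk1 hk2 => ih k (by omega) α μ hμ) (hcore m (fun k hk => ih k (by omega)) α μ hμ)

end SahiAbsorbed

end Summit.CriticalPhenomena.PercolationContinuityZ3.Theorems
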